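import Literature.NumberTheory.LFunctions.RayClassCharacter
import Literature.NumberTheory.LFunctions.DedekindZetaVonMangoldt
import HarnessLib

/-!
# Non-negative coefficients of `ζ_K(s) L(s,χ₁) L(s,χ₂) L(s,χ₁χ₂)` for real characters of a number field

Topic `Literature/NumberTheory/LFunctions`, the number-field analogue of `SiegelProductCoefficients.lean`
(`K = ℚ`, Dirichlet characters). Everything here is PROVED (definitions with bodies + theorems; no named facts).

**Purpose.** Montgomery–Vaughan, *Multiplicative Number Theory I*, proof of Theorem 11.14 (Siegel), p. 285:
"the Dirichlet series coefficients of `ζ(s)f(s)`", `f = L(s,χ₁)L(s,χ₂)L(s,χ₁χ₂)`, "are non-negative" (and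
`= 1` at `n = 1`). This is the input `coeff₃` (and, with `χ₂` trivialised, `coeff₁`) of the abstract Siegel
theorem `SiegelFamilyData.siegel` (`SiegelTheoremAbstract.lean`) for the family of REAL ray class characters
of a number field `K` — Siegel's theorem over `K` being the ineffective input of the prime number theorem
with Grössencharakteren uniform in the modulus (Mitsui 1956, Lemma 5; Heath-Brown, Acta Math. 186 (2001),
Lemma 9.4, p. 55).

**Method.** Instead of divisor sums over the ideals of `𝓞_K` we work with exponent vectors
`g : {primes of K} →₀ ℕ` (unique factorisation `g ↦ ∏ v^{g_v}`, `DedekindZetaProofs.lean`) and the tree's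
abstract Euler product `FinsuppEulerProduct.hasProd_tsum`. For `u, w : {primes} → ℂ` with values in
`{−1, 0, 1}` (the values `ψ'(v)` of two real ray class characters, `0` on their moduli):

* local coefficients: `h u i = ∑_{l ≤ i} u^l` (coefficients of `1/((1−x)(1−ux))`: `i + 1`, `1`, or
  `[i even]`), `cf u w k = ∑_{i+j=k} h_u(i) h_u(j) w^j` (of `1/((1−x)(1−ux)) · 1/((1−wx)(1−uwx))`), and
  `e u w k` = `cf u w k`, but computed as `cf w u k` when `w = −1`; with this choice EVERY TERM is
  non-negative (`e_nonneg`: `[i even][j even]u^j ≥ 0`, resp. `h_u(i)h_u(j)w^j` with `w ∈ {0,1}`), exactly the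
  "one of the two groupings" device of `SiegelProductCoefficients.lean`; `‖e u w k‖ ≤ ∑_{i+j=k}(i+1)(j+1)`;
* generating functions (Cauchy products of geometric series, Mathlib
  `tsum_mul_tsum_eq_tsum_sum_antidiagonal_of_summable_norm`): `∑ h_u(i)z^i = (1−z)⁻¹(1−uz)⁻¹`,
  **`∑_k e(u,w,k) z^k = (1−z)⁻¹(1−uz)⁻¹(1−wz)⁻¹(1−uwz)⁻¹`** (`hasSum_e_mul_pow`), and the real majorant
  `∑ (∑_{i+j=n}(i+1)(j+1)) r^n = (1−r)^{-4}`;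
* global coefficients `E(g) = ∏_v e(u_v, w_v, g_v) ≥ 0`, `r(∏ v^{g_v}) = E(g)`, `r(0) = 0`,
  `coeff u w n = ∑_{N𝔞 = n} r(𝔞)` (`≥ 0`, `= 1` at `n = 1`, `= 0` at `n = 0`);
* **absolute convergence** for `Re s > 1` (`summable_norm_prod_F`): the finite partial sums of
  `∑_g ‖∏_v e N(v)^{-sg_v}‖` are bounded by `∏_{v∈S}(1 − N v^{-σ})^{-4} ≤ (∑_g N(∏v^{g_v})^{-σ})^4 = ζ_K(σ)^4`
  (finite stage `FinsuppEulerProduct.summable_and_hasSum_support_subset`, `summable_of_sum_le`);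
* **the identity** (`tsum_prod_F_eq`, `LSeries_coeff_eq`): by `hasProd_tsum` and the local generating
  function, `∑_g ∏_v F = ∏_v (1−z_v)⁻¹(1−u_vz_v)⁻¹(1−w_vz_v)⁻¹(1−u_vw_vz_v)⁻¹`, which is
  `ζ_K(s) ∏(1−u_vz_v)⁻¹ ∏(1−w_vz_v)⁻¹ ∏(1−u_vw_vz_v)⁻¹` (Euler product of `ζ_K`,
  `hasProd_dedekindEulerFactor_holds`; `hasProd_inv_one_sub_twist`); regrouping the sum over nonzero ideals
  by norm (`HasSum.tsum_fiberwise`, as in `hasSum_absNorm_cpow`) gives `LSeriesHasSum (coeff u w) s`.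

**Results** (`namespace SiegelIdealCoefficients`): `exists_nonneg_coeff` (Euler-product form, four factors),
`exists_nonneg_coeff_pair` (`ζ_K · ∏(1−u_vz_v)⁻¹`), and in the language of `RayClassCharacter.lean`:
`exists_nonneg_coeff_rayClass` — for real ray class characters `χ₁ mod 𝔪₁`, `χ₂ mod 𝔪₂`,
`∑ a(n)n^{-s} = ζ_K(s)L(χ₁,s)L(χ₂,s)L(χ₁χ₂,s)`, `χ₁χ₂ mod 𝔪₁𝔪₂` (`rayClassPrimeValue_mul`), `a ≥ 0`,
`a(1) = 1` — and `exists_nonneg_coeff_rayClass_pair` (`ζ_K(s)L(χ,s)`).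

## References

* H. L. Montgomery, R. C. Vaughan, *Multiplicative Number Theory I. Classical Theory*, CUP 2007, §11.2,
  proof of Theorem 11.14, p. 285. [cite: MontgomeryVaughan2007, §11.2 p. 285]
* J. Neukirch, *Algebraic Number Theory*, Springer 1999, Ch. VII §1 (1.1) (Euler products), §8 (8.1).
  [cite: NeukirchANT1999, Ch. VII §8 (8.1) Proposition]
* D. R. Heath-Brown, *Primes represented by `x³ + 2y³`*, Acta Math. 186 (2001), §9 p. 55 (the use).
  [cite: HeathBrownActa2001, §9 Lemma 9.4]

## Mathlib / tree search

Tree: `FinsuppEulerProduct.hasProd_tsum`, `FinsuppEulerProduct.hasProd_inv_one_sub`,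
`FinsuppEulerProduct.summable_and_hasSum_support_subset`, `finsuppProd_asIdeal_pow_injective`,
`exists_finsuppProd_asIdeal_pow_eq`, `absNorm_finsuppProd_cpow`, `summable_norm_absNorm_cpow`,
`hasProd_dedekindEulerFactor_holds` (`DedekindZetaProofs.lean`); `rayClassPrimeValue`,
`hasProd_rayClassLSeries_rayClassPrimeValue` (`RayClassCharacter.lean`); `idealsOfNorm`, `idealsOfNorm_one`
(`DedekindZetaVonMangoldt.lean`); `SiegelCoefficients.coeff_nonneg` (`SiegelProductCoefficients.lean`, `K = ℚ` only).
Mathlib: `tsum_mul_tsum_eq_tsum_sum_antidiagonal_of_summable_norm`, `hasSum_coe_mul_geometric_of_norm_lt_one`,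
`summable_of_sum_le`, `Summable.tsum_subtype_le`, `hasSum_subtype_iff_indicator`, `HasSum.tsum_fiberwise`,
`Finset.tsum_subtype'`, `tsum_congr_set_coe`.
-/

noncomputable section

open Complex Filter Topology Set Finset IsDedekindDomain NumberField
open scoped ComplexOrder

namespace Literature.NumberTheory.LFunctions

open Literature.NumberTheory.LFunctions.NumberField (idealsOfNorm mem_idealsOfNorm idealsOfNorm_one)

namespace SiegelIdealCoefficients

/-! ### Local coefficients: `h_u(i) = ∑_{l ≤ i} u^l`, the Cauchy square `cf`, and `e` -/

/-- `h u i = ∑_{l=0}^{i} u^l`, the `i`-th coefficient of `1/((1 − x)(1 − ux))`. [folklore] -/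
def h (u : ℂ) (i : ℕ) : ℂ := ∑ l ∈ range (i + 1), u ^ l

/-- `cf u w k = ∑_{i+j=k} h_u(i) h_u(j) w^j`, the `k`-th coefficient of
`1/((1 − x)(1 − ux)) · 1/((1 − wx)(1 − uwx))`. [folklore] -/
def cf (u w : ℂ) (k : ℕ) : ℂ := ∑ p ∈ antidiagonal k, h u p.1 * (h u p.2 * w ^ p.2)

/-- The local coefficient `e u w k` of `1/((1−x)(1−ux)(1−wx)(1−uwx))`: `cf u w k`, computed through the
grouping `cf w u k` when `w = −1` (so that every term of the defining sum is non-negative when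
`u, w ∈ {−1, 0, 1}`; cf. `SiegelProductCoefficients.lean` for `K = ℚ`). [folklore] -/
def e (u w : ℂ) (k : ℕ) : ℂ := if w = -1 then cf w u k else cf u w k

/-- `h u 0 = 1`. [folklore] -/
theorem h_zero (u : ℂ) : h u 0 = 1 := by simp [h]

/-- `h u (i+1) = h u i + u^{i+1}`. [folklore] -/
theorem h_succ (u : ℂ) (i : ℕ) : h u (i + 1) = h u i + u ^ (i + 1) := by
  rw [h, h, Finset.sum_range_succ]

/-- `‖h u i‖ ≤ i + 1` for `‖u‖ ≤ 1`. [folklore] -/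
theorem norm_h_le {u : ℂ} (hu : ‖u‖ ≤ 1) (i : ℕ) : ‖h u i‖ ≤ i + 1 := by
  unfold h
  calc ‖∑ l ∈ range (i + 1), u ^ l‖ ≤ ∑ l ∈ range (i + 1), ‖u ^ l‖ := norm_sum_le _ _
    _ ≤ ∑ _l ∈ range (i + 1), (1 : ℝ) := Finset.sum_le_sum fun l _ => by
        rw [norm_pow]; exact pow_le_one₀ (norm_nonneg _) hu
    _ = i + 1 := by simp

/-- `h (−1) i = [i even]`. [folklore] -/
theorem h_neg_one (i : ℕ) : h (-1) i = if Even i then 1 else 0 := by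
  induction i with
  | zero => simp [h_zero]
  | succ i ih =>
    rw [h_succ, ih]
    rcases Nat.even_or_odd i with hi | hi
    · have : ¬ Even (i + 1) := Nat.not_even_iff_odd.mpr (Even.add_one hi)
      rw [if_pos hi, if_neg this, (Even.add_one hi).neg_one_pow]; ring
    · have : Even (i + 1) := hi.add_one
      rw [if_neg (Nat.not_even_iff_odd.mpr hi), if_pos this, this.neg_one_pow]; ring

/-- `h 1 i = i + 1`. [folklore] -/
theorem h_one (i : ℕ) : h 1 i = (i : ℂ) + 1 := by simp [h]

/-- `h 0 i = 1`. [folklore] -/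
theorem h_zero_base (i : ℕ) : h 0 i = 1 := by
  induction i with
  | zero => simp [h_zero]
  | succ i ih => rw [h_succ, ih, zero_pow (Nat.succ_ne_zero i), add_zero]

/-- `h u i ≥ 0` (real, non-negative) for `u ∈ {−1, 0, 1}`. [folklore] -/
theorem h_nonneg {u : ℂ} (hu : u = -1 ∨ u = 0 ∨ u = 1) (i : ℕ) : 0 ≤ h u i := by
  rcases hu with rfl | rfl | rfl
  · rw [h_neg_one]; split_ifs <;> simp
  · rw [h_zero_base]; exact zero_le_one
  · rw [h_one]; exact_mod_cast (by positivity : (0 : ℝ) ≤ (i : ℝ) + 1)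

/-- `e u w 0 = 1`. [folklore] -/
theorem e_zero (u w : ℂ) : e u w 0 = 1 := by
  unfold e cf
  split_ifs <;> simp [h_zero]

/-- **`e u w k ≥ 0`** for `u, w ∈ {−1, 0, 1}`: every term of the chosen grouping is non-negative
(for `w = −1`: `h_{−1}(i) h_{−1}(j) u^j = [i even][j even] u^j`, `u^{even} ≥ 0`; otherwise
`h_u(i) h_u(j) w^j` with `w ∈ {0, 1}`). [cite: MontgomeryVaughan2007, §11.2 p. 285] -/
theorem e_nonneg {u w : ℂ} (hu : u = -1 ∨ u = 0 ∨ u = 1) (hw : w = -1 ∨ w = 0 ∨ w = 1) (k : ℕ) :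
    0 ≤ e u w k := by
  unfold e cf
  split_ifs with hw1
  · subst hw1
    refine Finset.sum_nonneg fun p _ => mul_nonneg (h_nonneg (Or.inl rfl) _) ?_
    rw [h_neg_one]
    split_ifs with hj
    · rw [one_mul]
      obtain ⟨m, hm⟩ := hj
      rw [hm, ← two_mul, pow_mul]
      refine pow_nonneg ?_ _
      rcases hu with rfl | rfl | rfl <;> norm_num
    · rw [zero_mul]
  · have hw' : w = 0 ∨ w = 1 := by tauto
    refine Finset.sum_nonneg fun p _ => mul_nonneg (h_nonneg hu _) (mul_nonneg (h_nonneg hu _) ?_)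
    rcases hw' with rfl | rfl
    · exact pow_nonneg le_rfl _
    · rw [one_pow]; exact zero_le_one

/-- `‖cf u w k‖ ≤ ∑_{i+j=k} (i+1)(j+1)` for `‖u‖, ‖w‖ ≤ 1`. [folklore] -/
theorem norm_cf_le {u w : ℂ} (hu : ‖u‖ ≤ 1) (hw : ‖w‖ ≤ 1) (k : ℕ) :
    ‖cf u w k‖ ≤ ∑ p ∈ antidiagonal k, ((p.1 : ℝ) + 1) * ((p.2 : ℝ) + 1) := by
  unfold cf
  refine (norm_sum_le _ _).trans (Finset.sum_le_sum fun p _ => ?_)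
  rw [norm_mul, norm_mul, norm_pow]
  have h1 := norm_h_le hu p.1
  have h2 := norm_h_le hu p.2
  have h3 : ‖w‖ ^ p.2 ≤ 1 := pow_le_one₀ (norm_nonneg _) hw
  calc ‖h u p.1‖ * (‖h u p.2‖ * ‖w‖ ^ p.2) ≤ (p.1 + 1) * ((p.2 + 1) * 1) := by
        gcongr
    _ = ((p.1 : ℝ) + 1) * ((p.2 : ℝ) + 1) := by ring

/-- `‖e u w k‖ ≤ ∑_{i+j=k} (i+1)(j+1)`. [folklore] -/
theorem norm_e_le {u w : ℂ} (hu : ‖u‖ ≤ 1) (hw : ‖w‖ ≤ 1) (k : ℕ) :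
    ‖e u w k‖ ≤ ∑ p ∈ antidiagonal k, ((p.1 : ℝ) + 1) * ((p.2 : ℝ) + 1) := by
  unfold e
  split_ifs
  · exact norm_cf_le hw hu k
  · exact norm_cf_le hu hw k

/-! ### Generating functions (Cauchy products of geometric series) -/

/-- `∑ (n+1) r^n` converges for `0 ≤ r < 1`, with sum `((1 − r)^2)⁻¹`. [folklore] -/
theorem hasSum_succ_mul_geometric {r : ℝ} (hr0 : 0 ≤ r) (hr : r < 1) :
    HasSum (fun n : ℕ => ((n : ℝ) + 1) * r ^ n) ((1 - r) ^ 2)⁻¹ := by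
  have hr' : ‖r‖ < 1 := by rwa [Real.norm_of_nonneg hr0]
  have h1 := hasSum_coe_mul_geometric_of_norm_lt_one hr'
  have h2 := hasSum_geometric_of_lt_one hr0 hr
  have h3 := h1.add h2
  have e1 : (fun n : ℕ => ((n : ℝ) + 1) * r ^ n) = fun n : ℕ => (n : ℝ) * r ^ n + r ^ n := by
    funext n; ring
  have hr1 : 1 - r ≠ 0 := by linarith
  have e2 : ((1 - r) ^ 2)⁻¹ = r / (1 - r) ^ 2 + (1 - r)⁻¹ := by
    field_simp
    ring
  rw [e1, e2]
  exact h3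

/-- `∑_i h_u(i) z^i = (1 − z)⁻¹ (1 − uz)⁻¹` for `‖z‖ < 1`, `‖u‖ ≤ 1`, with absolute convergence.
[folklore] -/
theorem hasSum_h_mul_pow {u z : ℂ} (hu : ‖u‖ ≤ 1) (hz : ‖z‖ < 1) :
    HasSum (fun i : ℕ => h u i * z ^ i) ((1 - z)⁻¹ * (1 - u * z)⁻¹) := by
  have huz : ‖u * z‖ < 1 := by
    rw [norm_mul]; exact (mul_le_of_le_one_left (norm_nonneg _) hu).trans_lt hz
  have hf : Summable fun i : ℕ => ‖z ^ i‖ := by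
    simp only [norm_pow]; exact summable_geometric_of_lt_one (norm_nonneg _) hz
  have hg : Summable fun i : ℕ => ‖(u * z) ^ i‖ := by
    simp only [norm_pow]; exact summable_geometric_of_lt_one (norm_nonneg _) huz
  have hprod := tsum_mul_tsum_eq_tsum_sum_antidiagonal_of_summable_norm hf hg
  rw [tsum_geometric_of_norm_lt_one hz, tsum_geometric_of_norm_lt_one huz] at hprod
  have hsum : Summable fun n : ℕ => ∑ kl ∈ antidiagonal n, z ^ kl.1 * (u * z) ^ kl.2 :=
    (summable_norm_sum_mul_antidiagonal_of_summable_norm hf hg).of_norm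
  have heq : (fun n : ℕ => ∑ kl ∈ antidiagonal n, z ^ kl.1 * (u * z) ^ kl.2) = fun i => h u i * z ^ i := by
    funext n
    rw [h, Finset.sum_mul, ← Finset.Nat.sum_antidiagonal_swap,
      Finset.Nat.sum_antidiagonal_eq_sum_range_succ_mk]
    refine Finset.sum_congr rfl fun k hk => ?_
    have hk' : k ≤ n := Nat.lt_succ_iff.mp (Finset.mem_range.mp hk)
    simp only [Prod.swap_prod_mk]
    rw [mul_pow, show z ^ (n - k) * (u ^ k * z ^ k) = u ^ k * (z ^ (n - k) * z ^ k) by ring, ← pow_add,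
      Nat.sub_add_cancel hk']
  rw [heq] at hsum hprod
  rw [hprod]
  exact hsum.hasSum

/-- Summability of `∑ ‖h_u(i) z^i‖` (`≤ ∑ (i+1)‖z‖^i`). [folklore] -/
theorem summable_norm_h_mul_pow {u z : ℂ} (hu : ‖u‖ ≤ 1) (hz : ‖z‖ < 1) :
    Summable fun i : ℕ => ‖h u i * z ^ i‖ := by
  refine Summable.of_nonneg_of_le (fun _ => norm_nonneg _) (fun i => ?_)
    (hasSum_succ_mul_geometric (norm_nonneg z) hz).summable
  rw [norm_mul, norm_pow]
  exact mul_le_mul_of_nonneg_right (norm_h_le hu i) (pow_nonneg (norm_nonneg _) _)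

/-- **`∑_k cf(u,w,k) z^k = (1−z)⁻¹(1−uz)⁻¹ · (1−wz)⁻¹(1−uwz)⁻¹`** (`‖z‖ < 1`, `‖u‖, ‖w‖ ≤ 1`). [folklore] -/
theorem hasSum_cf_mul_pow {u w z : ℂ} (hu : ‖u‖ ≤ 1) (hw : ‖w‖ ≤ 1) (hz : ‖z‖ < 1) :
    HasSum (fun k : ℕ => cf u w k * z ^ k)
      ((1 - z)⁻¹ * (1 - u * z)⁻¹ * ((1 - w * z)⁻¹ * (1 - u * (w * z))⁻¹)) := by
  have hwz : ‖w * z‖ < 1 := by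
    rw [norm_mul]; exact (mul_le_of_le_one_left (norm_nonneg _) hw).trans_lt hz
  have hf := summable_norm_h_mul_pow hu hz
  have hg := summable_norm_h_mul_pow hu hwz
  have hprod := tsum_mul_tsum_eq_tsum_sum_antidiagonal_of_summable_norm hf hg
  rw [(hasSum_h_mul_pow hu hz).tsum_eq, (hasSum_h_mul_pow hu hwz).tsum_eq] at hprod
  have hsum : Summable fun n : ℕ =>
      ∑ kl ∈ antidiagonal n, h u kl.1 * z ^ kl.1 * (h u kl.2 * (w * z) ^ kl.2) :=
    (summable_norm_sum_mul_antidiagonal_of_summable_norm hf hg).of_norm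
  have heq : (fun n : ℕ => ∑ kl ∈ antidiagonal n, h u kl.1 * z ^ kl.1 * (h u kl.2 * (w * z) ^ kl.2)) =
      fun k => cf u w k * z ^ k := by
    funext n
    rw [cf, Finset.sum_mul]
    refine Finset.sum_congr rfl fun p hp => ?_
    have hpn : p.1 + p.2 = n := Finset.mem_antidiagonal.mp hp
    rw [mul_pow, ← hpn, pow_add]
    ring
  rw [heq] at hsum hprod
  rw [hprod]
  exact hsum.hasSum

/-- **`∑_k e(u,w,k) z^k = (1−z)⁻¹(1−uz)⁻¹(1−wz)⁻¹(1−uwz)⁻¹`** (`‖z‖ < 1`, `‖u‖, ‖w‖ ≤ 1`). [folklore] -/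
theorem hasSum_e_mul_pow {u w z : ℂ} (hu : ‖u‖ ≤ 1) (hw : ‖w‖ ≤ 1) (hz : ‖z‖ < 1) :
    HasSum (fun k : ℕ => e u w k * z ^ k)
      ((1 - z)⁻¹ * (1 - u * z)⁻¹ * (1 - w * z)⁻¹ * (1 - u * w * z)⁻¹) := by
  unfold e
  split_ifs with h1
  · have := hasSum_cf_mul_pow hw hu hz
    convert this using 1
    ring_nf
  · have := hasSum_cf_mul_pow hu hw hz
    convert this using 1
    ring_nf

/-- The real majorant: `∑_n (∑_{i+j=n} (i+1)(j+1)) r^n = (1 − r)^{-4}` for `0 ≤ r < 1`. [folklore] -/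
theorem hasSum_majorant {r : ℝ} (hr0 : 0 ≤ r) (hr : r < 1) :
    HasSum (fun n : ℕ => (∑ p ∈ antidiagonal n, ((p.1 : ℝ) + 1) * ((p.2 : ℝ) + 1)) * r ^ n)
      (((1 - r) ^ 2)⁻¹ * ((1 - r) ^ 2)⁻¹) := by
  have hf : Summable fun i : ℕ => ‖((i : ℝ) + 1) * r ^ i‖ := by
    refine (hasSum_succ_mul_geometric hr0 hr).summable.congr fun i => ?_
    rw [Real.norm_of_nonneg (by positivity)]
  have hprod := tsum_mul_tsum_eq_tsum_sum_antidiagonal_of_summable_norm hf hf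
  rw [(hasSum_succ_mul_geometric hr0 hr).tsum_eq] at hprod
  have hsum : Summable fun n : ℕ =>
      ∑ kl ∈ antidiagonal n, ((kl.1 : ℝ) + 1) * r ^ kl.1 * (((kl.2 : ℝ) + 1) * r ^ kl.2) :=
    (summable_norm_sum_mul_antidiagonal_of_summable_norm hf hf).of_norm
  have heq : (fun n : ℕ => ∑ kl ∈ antidiagonal n, ((kl.1 : ℝ) + 1) * r ^ kl.1 * (((kl.2 : ℝ) + 1) * r ^ kl.2)) =
      fun n : ℕ => (∑ p ∈ antidiagonal n, ((p.1 : ℝ) + 1) * ((p.2 : ℝ) + 1)) * r ^ n := by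
    funext n
    rw [Finset.sum_mul]
    refine Finset.sum_congr rfl fun p hp => ?_
    have hpn : p.1 + p.2 = n := Finset.mem_antidiagonal.mp hp
    rw [← hpn, pow_add]
    ring
  rw [heq] at hsum hprod
  rw [hprod]
  exact hsum.hasSum

/-- **Local absolute bound**: `∑_k ‖e(u,w,k)‖ r^k ≤ (1 − r)^{-4}` (`0 ≤ r < 1`), with summability. [folklore] -/
theorem summable_norm_e_mul_pow {u w : ℂ} (hu : ‖u‖ ≤ 1) (hw : ‖w‖ ≤ 1) {r : ℝ} (hr0 : 0 ≤ r) (hr : r < 1) :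
    Summable (fun k : ℕ => ‖e u w k‖ * r ^ k) ∧
      ∑' k : ℕ, ‖e u w k‖ * r ^ k ≤ ((1 - r) ^ 2)⁻¹ * ((1 - r) ^ 2)⁻¹ := by
  have hM := hasSum_majorant hr0 hr
  have hle : ∀ k : ℕ, ‖e u w k‖ * r ^ k ≤ (∑ p ∈ antidiagonal k, ((p.1 : ℝ) + 1) * ((p.2 : ℝ) + 1)) * r ^ k :=
    fun k => mul_le_mul_of_nonneg_right (norm_e_le hu hw k) (pow_nonneg hr0 k)
  have hnn : ∀ k : ℕ, 0 ≤ ‖e u w k‖ * r ^ k := fun k => by positivity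
  have hS : Summable fun k : ℕ => ‖e u w k‖ * r ^ k := Summable.of_nonneg_of_le hnn hle hM.summable
  exact ⟨hS, hasSum_le hle hS.hasSum hM⟩

end SiegelIdealCoefficients

/-! ### The global coefficients over the ideals of `K` -/

namespace SiegelIdealCoefficients

variable {K : Type*} [Field K] [NumberField K]

/-- `N(v) ≥ 2` for a nonzero prime `v` (`N(v) ≠ 0, 1`). [folklore] -/
theorem one_lt_absNorm' (v : HeightOneSpectrum (𝓞 K)) : 1 < Ideal.absNorm v.asIdeal := by
  have h0 : Ideal.absNorm v.asIdeal ≠ 0 := by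
    rw [Ne, Ideal.absNorm_eq_zero_iff]; exact v.ne_bot
  have h1 : Ideal.absNorm v.asIdeal ≠ 1 := by
    rw [Ne, Ideal.absNorm_eq_one_iff]; exact v.isPrime.ne_top
  omega

/-- `‖N(v)^{-s}‖ < 1` for `Re s > 0` (`N(v) ≥ 2`). [folklore] -/
theorem norm_absNorm_cpow_neg_lt_one' (v : HeightOneSpectrum (𝓞 K)) {s : ℂ} (hs : 0 < s.re) :
    ‖((Ideal.absNorm v.asIdeal : ℕ) : ℂ) ^ (-s)‖ < 1 := by
  have h2 := one_lt_absNorm' v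
  have hpos : 0 < Ideal.absNorm v.asIdeal := lt_trans zero_lt_one h2
  rw [Complex.norm_natCast_cpow_of_pos hpos, Complex.neg_re]
  exact Real.rpow_lt_one_of_one_lt_of_neg (by exact_mod_cast h2) (by linarith)

/-- `‖N(v)^{-s}‖ = N(v)^{-Re s}`. [folklore] -/
theorem norm_absNorm_cpow_neg (v : HeightOneSpectrum (𝓞 K)) (s : ℂ) :
    ‖((Ideal.absNorm v.asIdeal : ℕ) : ℂ) ^ (-s)‖ = (Ideal.absNorm v.asIdeal : ℝ) ^ (-s.re) := by
  have hpos : 0 < Ideal.absNorm v.asIdeal := lt_trans zero_lt_one (one_lt_absNorm' v)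
  rw [Complex.norm_natCast_cpow_of_pos hpos, Complex.neg_re]

variable {u w : HeightOneSpectrum (𝓞 K) → ℂ}

/-- The local Euler-factor coefficients `F_s(v, k) = e(u_v, w_v, k) (N(v)^{-s})^k`. [folklore] -/
def F (u w : HeightOneSpectrum (𝓞 K) → ℂ) (s : ℂ) (v : HeightOneSpectrum (𝓞 K)) (k : ℕ) : ℂ :=
  e (u v) (w v) k * (((Ideal.absNorm v.asIdeal : ℕ) : ℂ) ^ (-s)) ^ k

/-- The coefficient `E(g) = ∏_v e(u_v, w_v, g_v)` attached to the exponent vector `g` (the value on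
the ideal `∏ v^{g_v}` of the multiplicative function `1 ⋆ χ₁ ⋆ χ₂ ⋆ χ₁χ₂` on ideals). [folklore] -/
def E (u w : HeightOneSpectrum (𝓞 K) → ℂ) (g : HeightOneSpectrum (𝓞 K) →₀ ℕ) : ℂ :=
  g.prod fun v k => e (u v) (w v) k

/-- `F_s(v, 0) = 1`. [folklore] -/
theorem F_zero (s : ℂ) (v : HeightOneSpectrum (𝓞 K)) : F u w s v 0 = 1 := by
  simp [F, e_zero]

omit [NumberField K] in
/-- `E(g) ≥ 0` when `u, w` take values in `{−1, 0, 1}`. [cite: MontgomeryVaughan2007, §11.2 p. 285] -/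
theorem E_nonneg (hu : ∀ v, u v = -1 ∨ u v = 0 ∨ u v = 1) (hw : ∀ v, w v = -1 ∨ w v = 0 ∨ w v = 1)
    (g : HeightOneSpectrum (𝓞 K) →₀ ℕ) : 0 ≤ E u w g :=
  Finset.prod_nonneg fun v _ => e_nonneg (hu v) (hw v) _

omit [NumberField K] in
/-- `E(0) = 1`. [folklore] -/
theorem E_zero' : E u w 0 = 1 := by simp [E]

/-- `∏_v F_s(v, g_v) = E(g) · N(∏ v^{g_v})^{-s}`. [folklore] -/
theorem prod_F_eq {s : ℂ} (hs : s ≠ 0) (g : HeightOneSpectrum (𝓞 K) →₀ ℕ) :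
    g.prod (F u w s) = E u w g *
      ((Ideal.absNorm (g.prod fun v k => v.asIdeal ^ k) : ℕ) : ℂ) ^ (-s) := by
  rw [absNorm_finsuppProd_cpow K hs, E, Finsupp.prod, Finsupp.prod, Finsupp.prod, ← Finset.prod_mul_distrib]
  rfl

/-! ### Absolute convergence over all exponent vectors for `Re s > 1` -/

section Summability

variable (hu1 : ∀ v, ‖u v‖ ≤ 1) (hw1 : ∀ v, ‖w v‖ ≤ 1)
include hu1 hw1

omit hu1 hw1 in
/-- The `ζ_K`-majorant: `g ↦ ∏_v (N(v)^{-σ})^{g_v}` is summable over all exponent vectors for `σ > 1`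
(transport of `∑_𝔞 N(𝔞)^{-σ} < ∞` along unique factorisation). [folklore] -/
theorem summable_prod_rpow {s : ℂ} (hs : 1 < s.re) :
    Summable fun g : HeightOneSpectrum (𝓞 K) →₀ ℕ =>
      g.prod fun v k => ((Ideal.absNorm v.asIdeal : ℝ) ^ (-s.re)) ^ k := by
  have hs0 : s ≠ 0 := fun h0 => by rw [h0, Complex.zero_re] at hs; linarith
  have hkey := absNorm_finsuppProd_cpow K hs0
  have hinj := finsuppProd_asIdeal_pow_injective (R := 𝓞 K)
  have h1 : Summable fun g : HeightOneSpectrum (𝓞 K) →₀ ℕ =>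
      ‖g.prod fun v k => (((Ideal.absNorm v.asIdeal : ℕ) : ℂ) ^ (-s)) ^ k‖ := by
    simp only [← hkey]
    exact (summable_norm_absNorm_cpow K hs).comp_injective hinj
  refine h1.congr fun g => ?_
  rw [Finsupp.prod, Finsupp.prod, norm_prod]
  refine Finset.prod_congr rfl fun v _ => ?_
  rw [norm_pow, norm_absNorm_cpow_neg]

/-- **`∑_g ‖∏_v F_s(v, g_v)‖ < ∞` for `Re s > 1`**: finite partial sums are bounded by
`∏_{v ∈ S} ∑_k ‖e‖ N(v)^{-kσ} ≤ ∏_{v∈S} (1 − N(v)^{-σ})^{-4} ≤ (∑_𝔞 N(𝔞)^{-σ})^4`. [folklore] -/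
theorem summable_norm_prod_F {s : ℂ} (hs : 1 < s.re) :
    Summable fun g : HeightOneSpectrum (𝓞 K) →₀ ℕ => ‖g.prod (F u w s)‖ := by
  classical
  set y : HeightOneSpectrum (𝓞 K) → ℝ := fun v => (Ideal.absNorm v.asIdeal : ℝ) ^ (-s.re) with hy
  have hy0 : ∀ v, 0 ≤ y v := fun v => Real.rpow_nonneg (Nat.cast_nonneg _) _
  have hy1 : ∀ v, y v < 1 := fun v => by
    have := norm_absNorm_cpow_neg_lt_one' v (s := s) (lt_trans zero_lt_one hs)
    rwa [norm_absNorm_cpow_neg] at this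
  set G : HeightOneSpectrum (𝓞 K) → ℕ → ℝ := fun v k => ‖e (u v) (w v) k‖ * y v ^ k with hG
  have hG0 : ∀ v, G v 0 = 1 := fun v => by simp [hG, e_zero]
  have hGnn : ∀ v k, 0 ≤ G v k := fun v k => mul_nonneg (norm_nonneg _) (pow_nonneg (hy0 v) k)
  have hnormF : ∀ g : HeightOneSpectrum (𝓞 K) →₀ ℕ, ‖g.prod (F u w s)‖ = g.prod G := by
    intro g
    rw [Finsupp.prod, Finsupp.prod, norm_prod]
    refine Finset.prod_congr rfl fun v _ => ?_
    rw [F, norm_mul, norm_pow, norm_absNorm_cpow_neg]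
  have hGprod_nn : ∀ g : HeightOneSpectrum (𝓞 K) →₀ ℕ, 0 ≤ g.prod G := fun g =>
    Finset.prod_nonneg fun v _ => hGnn v _
  -- local sums
  have hloc : ∀ v, Summable (G v) ∧ ∑' k, G v k ≤ ((1 - y v) ^ 2)⁻¹ * ((1 - y v) ^ 2)⁻¹ :=
    fun v => summable_norm_e_mul_pow (hu1 v) (hw1 v) (hy0 v) (hy1 v)
  have hGloc : ∀ v, Summable fun k => ‖G v k‖ := fun v =>
    ((hloc v).1).congr fun k => (Real.norm_of_nonneg (hGnn v k)).symm
  -- the `ζ_K` majorant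
  set Y : HeightOneSpectrum (𝓞 K) → ℕ → ℝ := fun v k => y v ^ k with hY
  have hYsum : Summable fun g : HeightOneSpectrum (𝓞 K) →₀ ℕ => g.prod Y := summable_prod_rpow hs
  have hYnn : ∀ g : HeightOneSpectrum (𝓞 K) →₀ ℕ, 0 ≤ g.prod Y := fun g =>
    Finset.prod_nonneg fun v _ => pow_nonneg (hy0 v) _
  set ZK : ℝ := ∑' g : HeightOneSpectrum (𝓞 K) →₀ ℕ, g.prod Y with hZK
  have hY0 : ∀ v, Y v 0 = 1 := fun v => pow_zero _
  have hYloc : ∀ v, Summable fun k => ‖Y v k‖ := fun v => by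
    simp only [hY, norm_pow, Real.norm_of_nonneg (hy0 v)]
    exact summable_geometric_of_lt_one (hy0 v) (hy1 v)
  have hprodS : ∀ S : Finset (HeightOneSpectrum (𝓞 K)), ∏ v ∈ S, (1 - y v)⁻¹ ≤ ZK := by
    intro S
    have h := (FinsuppEulerProduct.summable_and_hasSum_support_subset hY0 hYloc S).2
    have htsum : ∀ v, ∑' k, Y v k = (1 - y v)⁻¹ := fun v => tsum_geometric_of_lt_one (hy0 v) (hy1 v)
    simp only [htsum] at h
    rw [← h.tsum_eq]
    exact hYsum.tsum_subtype_le (fun g : HeightOneSpectrum (𝓞 K) →₀ ℕ => g.prod Y) _ hYnn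
  -- uniform bound for the finite partial sums of `g.prod G`
  have hbound : ∀ T : Finset (HeightOneSpectrum (𝓞 K) →₀ ℕ), ∑ g ∈ T, g.prod G ≤ ZK ^ 4 := by
    intro T
    set S : Finset (HeightOneSpectrum (𝓞 K)) := T.biUnion Finsupp.support with hS
    have hT : ∀ g ∈ T, g.support ⊆ S := fun g hg => Finset.subset_biUnion_of_mem Finsupp.support hg
    have h : HasSum (Set.indicator {g : HeightOneSpectrum (𝓞 K) →₀ ℕ | g.support ⊆ S}
        (fun g : HeightOneSpectrum (𝓞 K) →₀ ℕ => g.prod G)) (∏ v ∈ S, ∑' k, G v k) :=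
      (hasSum_subtype_iff_indicator (f := fun g : HeightOneSpectrum (𝓞 K) →₀ ℕ => g.prod G)
        (s := {g : HeightOneSpectrum (𝓞 K) →₀ ℕ | g.support ⊆ S})).mp
        (FinsuppEulerProduct.summable_and_hasSum_support_subset hG0 hGloc S).2
    have hind_nn : ∀ g : HeightOneSpectrum (𝓞 K) →₀ ℕ,
        0 ≤ Set.indicator {g : HeightOneSpectrum (𝓞 K) →₀ ℕ | g.support ⊆ S}
          (fun g : HeightOneSpectrum (𝓞 K) →₀ ℕ => g.prod G) g :=
      fun g => Set.indicator_nonneg (fun g _ => hGprod_nn g) g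
    have h1 : ∑ g ∈ T, g.prod G ≤ ∏ v ∈ S, ∑' k, G v k := by
      have heq : ∑ g ∈ T, g.prod G = ∑ g ∈ T, Set.indicator {g : HeightOneSpectrum (𝓞 K) →₀ ℕ | g.support ⊆ S}
          (fun g : HeightOneSpectrum (𝓞 K) →₀ ℕ => g.prod G) g :=
        Finset.sum_congr rfl fun g hg => by
          rw [Set.indicator_of_mem (show g ∈ {g : HeightOneSpectrum (𝓞 K) →₀ ℕ | g.support ⊆ S} from hT g hg)]
      rw [heq]
      exact sum_le_hasSum T (fun g _ => hind_nn g) h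
    have h2 : ∏ v ∈ S, ∑' k, G v k ≤ ∏ v ∈ S, ((1 - y v) ^ 2)⁻¹ * ((1 - y v) ^ 2)⁻¹ :=
      Finset.prod_le_prod (fun v _ => tsum_nonneg (hGnn v)) fun v _ => (hloc v).2
    have h3 : ∏ v ∈ S, ((1 - y v) ^ 2)⁻¹ * ((1 - y v) ^ 2)⁻¹ = (∏ v ∈ S, (1 - y v)⁻¹) ^ 4 := by
      rw [← Finset.prod_pow]
      refine Finset.prod_congr rfl fun v _ => ?_
      have : 1 - y v ≠ 0 := by linarith [hy1 v]
      field_simp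
    have h4 : (∏ v ∈ S, (1 - y v)⁻¹) ^ 4 ≤ ZK ^ 4 :=
      pow_le_pow_left₀ (Finset.prod_nonneg fun v _ => inv_nonneg.mpr (by linarith [hy1 v])) (hprodS S) 4
    linarith [h3 ▸ h2]
  have hsum : Summable fun g : HeightOneSpectrum (𝓞 K) →₀ ℕ => g.prod G := summable_of_sum_le hGprod_nn hbound
  exact hsum.congr fun g => (hnormF g).symm

omit hu1 hw1 in
/-- Summability of `g ↦ ∏_v (c_v N(v)^{-s})^{g_v}` for `|c_v| ≤ 1`, `Re s > 1` (majorant `ζ_K(σ)`). [folklore] -/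
theorem summable_norm_prod_pow {c : HeightOneSpectrum (𝓞 K) → ℂ} (hc : ∀ v, ‖c v‖ ≤ 1) {s : ℂ} (hs : 1 < s.re) :
    Summable fun g : HeightOneSpectrum (𝓞 K) →₀ ℕ =>
      ‖g.prod fun v k => (c v * ((Ideal.absNorm v.asIdeal : ℕ) : ℂ) ^ (-s)) ^ k‖ := by
  refine Summable.of_nonneg_of_le (fun _ => norm_nonneg _) (fun g => ?_) (summable_prod_rpow hs)
  rw [Finsupp.prod, Finsupp.prod, norm_prod]
  refine Finset.prod_le_prod (fun v _ => norm_nonneg _) fun v _ => ?_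
  rw [norm_pow, norm_mul, norm_absNorm_cpow_neg]
  refine pow_le_pow_left₀ (by positivity) ?_ _
  exact mul_le_of_le_one_left (Real.rpow_nonneg (Nat.cast_nonneg _) _) (hc v)

omit hu1 hw1 in
/-- **Euler product of the twist**: `∏_v (1 − c_v N(v)^{-s})⁻¹` converges (unconditionally) to
`∑_g ∏_v (c_v N v^{-s})^{g_v}` for `|c_v| ≤ 1`, `Re s > 1`. [cite: NeukirchANT1999, Ch. VII §8 (8.1) Proposition] -/
theorem hasProd_inv_one_sub_twist {c : HeightOneSpectrum (𝓞 K) → ℂ} (hc : ∀ v, ‖c v‖ ≤ 1) {s : ℂ}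
    (hs : 1 < s.re) :
    HasProd (fun v : HeightOneSpectrum (𝓞 K) => (1 - c v * ((Ideal.absNorm v.asIdeal : ℕ) : ℂ) ^ (-s))⁻¹)
      (∑' g : HeightOneSpectrum (𝓞 K) →₀ ℕ,
        g.prod fun v k => (c v * ((Ideal.absNorm v.asIdeal : ℕ) : ℂ) ^ (-s)) ^ k) :=
  FinsuppEulerProduct.hasProd_inv_one_sub (summable_norm_prod_pow hc hs)

/-- **The Euler product identity**: for `Re s > 1`,
`∑_g E(g) N(∏v^{g_v})^{-s} = ζ_K(s) · ∏(1−u_vN v^{-s})⁻¹ · ∏(1−w_vN v^{-s})⁻¹ · ∏(1−u_vw_vN v^{-s})⁻¹`.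
[cite: MontgomeryVaughan2007, §11.2 p. 285] -/
theorem tsum_prod_F_eq {s : ℂ} (hs : 1 < s.re) :
    ∑' g : HeightOneSpectrum (𝓞 K) →₀ ℕ, g.prod (F u w s) =
      _root_.NumberField.dedekindZeta K s *
        (∏' v : HeightOneSpectrum (𝓞 K), (1 - u v * ((Ideal.absNorm v.asIdeal : ℕ) : ℂ) ^ (-s))⁻¹) *
        (∏' v : HeightOneSpectrum (𝓞 K), (1 - w v * ((Ideal.absNorm v.asIdeal : ℕ) : ℂ) ^ (-s))⁻¹) *
        ∏' v : HeightOneSpectrum (𝓞 K), (1 - u v * w v * ((Ideal.absNorm v.asIdeal : ℕ) : ℂ) ^ (-s))⁻¹ := by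
  have huw1 : ∀ v, ‖u v * w v‖ ≤ 1 := fun v => by
    rw [norm_mul]; exact mul_le_one₀ (hu1 v) (norm_nonneg _) (hw1 v)
  have hF := FinsuppEulerProduct.hasProd_tsum (F := F u w s) (F_zero s) (summable_norm_prod_F hu1 hw1 hs)
  have hloc : ∀ v : HeightOneSpectrum (𝓞 K), ∑' k, F u w s v k =
      (1 - ((Ideal.absNorm v.asIdeal : ℕ) : ℂ) ^ (-s))⁻¹ *
        (1 - u v * ((Ideal.absNorm v.asIdeal : ℕ) : ℂ) ^ (-s))⁻¹ *
        (1 - w v * ((Ideal.absNorm v.asIdeal : ℕ) : ℂ) ^ (-s))⁻¹ *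
        (1 - u v * w v * ((Ideal.absNorm v.asIdeal : ℕ) : ℂ) ^ (-s))⁻¹ := fun v =>
    (hasSum_e_mul_pow (hu1 v) (hw1 v) (norm_absNorm_cpow_neg_lt_one' v (lt_trans zero_lt_one hs))).tsum_eq
  simp only [hloc] at hF
  have hζ : HasProd (fun v : HeightOneSpectrum (𝓞 K) =>
      (1 - ((Ideal.absNorm v.asIdeal : ℕ) : ℂ) ^ (-s))⁻¹) (_root_.NumberField.dedekindZeta K s) :=
    hasProd_dedekindEulerFactor_holds K hs
  have hu' := hasProd_inv_one_sub_twist hu1 hs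
  have hw' := hasProd_inv_one_sub_twist hw1 hs
  have huw' := hasProd_inv_one_sub_twist huw1 hs
  have hall := ((hζ.mul hu').mul hw').mul huw'
  rw [hu'.tprod_eq, hw'.tprod_eq, huw'.tprod_eq]
  exact hF.unique hall

end Summability

/-! ### The Dirichlet coefficients `a(n) = ∑_{N(𝔞) = n} r(𝔞)` -/

open scoped Classical in
/-- The coefficient `r(𝔞) = E(g)` for `𝔞 = ∏ v^{g_v} ≠ 0`, `r(0) = 0` (the value on `𝔞` of
`1 ⋆ χ₁ ⋆ χ₂ ⋆ χ₁χ₂`). [folklore] -/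
def r (u w : HeightOneSpectrum (𝓞 K) → ℂ) (I : Ideal (𝓞 K)) : ℂ :=
  if hI : I = ⊥ then 0 else E u w (Classical.choose (exists_finsuppProd_asIdeal_pow_eq hI))

/-- The Dirichlet coefficients `a(n) = ∑_{N(𝔞) = n} r(𝔞)` of `ζ_K(s) L(s,χ₁) L(s,χ₂) L(s,χ₁χ₂)`. [folklore] -/
def coeff (u w : HeightOneSpectrum (𝓞 K) → ℂ) (n : ℕ) : ℂ := ∑ I ∈ idealsOfNorm K n, r u w I

/-- `r(0) = 0`. [folklore] -/
theorem r_bot : r u w (⊥ : Ideal (𝓞 K)) = 0 := by simp [r]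

/-- `r(∏ v^{g_v}) = E(g)` (uniqueness of the factorisation). [folklore] -/
theorem r_finsuppProd (g : HeightOneSpectrum (𝓞 K) →₀ ℕ) :
    r u w (g.prod fun v k => v.asIdeal ^ k) = E u w g := by
  have hne : (g.prod fun v k => v.asIdeal ^ k) ≠ ⊥ := finsuppProd_asIdeal_pow_ne_zero g
  rw [r, dif_neg hne]
  have hspec := Classical.choose_spec (exists_finsuppProd_asIdeal_pow_eq hne)
  rw [finsuppProd_asIdeal_pow_injective hspec]

/-- `r(𝔞) ≥ 0` when `u, w` take values in `{−1, 0, 1}`. [folklore] -/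
theorem r_nonneg (hu : ∀ v, u v = -1 ∨ u v = 0 ∨ u v = 1) (hw : ∀ v, w v = -1 ∨ w v = 0 ∨ w v = 1)
    (I : Ideal (𝓞 K)) : 0 ≤ r u w I := by
  unfold r
  split_ifs
  · exact le_rfl
  · exact E_nonneg hu hw _

/-- `a(n) ≥ 0`. [cite: MontgomeryVaughan2007, §11.2 p. 285] -/
theorem coeff_nonneg (hu : ∀ v, u v = -1 ∨ u v = 0 ∨ u v = 1) (hw : ∀ v, w v = -1 ∨ w v = 0 ∨ w v = 1) :
    0 ≤ coeff u w := fun _ => Finset.sum_nonneg fun I _ => r_nonneg hu hw I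

/-- `a(1) = 1`. [folklore] -/
theorem coeff_one : coeff u w 1 = 1 := by
  rw [coeff, idealsOfNorm_one, Finset.sum_singleton]
  have h := r_finsuppProd (u := u) (w := w) 0
  rw [Finsupp.prod_zero_index] at h
  rw [← Ideal.one_eq_top, h, E_zero']

/-- `a(0) = 0`. [folklore] -/
theorem coeff_zero : coeff u w 0 = 0 := by
  rw [coeff]
  have : idealsOfNorm K 0 = {⊥} := by
    ext I; simp [Ideal.absNorm_eq_zero_iff]
  rw [this, Finset.sum_singleton, r_bot]

section LSeriesIdentity

variable (hu1 : ∀ v, ‖u v‖ ≤ 1) (hw1 : ∀ v, ‖w v‖ ≤ 1)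
include hu1 hw1

/-- **`∑ a(n) n^{-s}` converges absolutely for `Re s > 1` and equals `∑_g ∏_v F_s(v, g_v)`**
(regroup the sum over nonzero ideals by norm, `HasSum.tsum_fiberwise`). [folklore] -/
theorem LSeriesHasSum_coeff {s : ℂ} (hs : 1 < s.re) :
    LSeriesHasSum (coeff u w) s (∑' g : HeightOneSpectrum (𝓞 K) →₀ ℕ, g.prod (F u w s)) := by
  have hs0 : s ≠ 0 := fun h0 => by rw [h0, Complex.zero_re] at hs; linarith
  have hinj := finsuppProd_asIdeal_pow_injective (R := 𝓞 K)
  -- the summand on ideals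
  set f : Ideal (𝓞 K) → ℂ := fun I => r u w I * ((Ideal.absNorm I : ℕ) : ℂ) ^ (-s) with hf
  have hfg : ∀ g : HeightOneSpectrum (𝓞 K) →₀ ℕ, f (g.prod fun v k => v.asIdeal ^ k) = g.prod (F u w s) := by
    intro g
    rw [hf]
    dsimp only
    rw [r_finsuppProd, prod_F_eq hs0]
  have hsupp : ∀ I ∉ Set.range (fun g : HeightOneSpectrum (𝓞 K) →₀ ℕ => g.prod fun v k => v.asIdeal ^ k),
      f I = 0 := by
    intro I hI
    have hI0 : I = ⊥ := by
      by_contra hne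
      exact hI (mem_range_finsuppProd_asIdeal_pow_iff.mpr hne)
    rw [hI0, hf]
    dsimp only
    rw [r_bot, zero_mul]
  have hfsum : Summable f := by
    refine (hinj.summable_iff hsupp).mp ?_
    have : (f ∘ fun g : HeightOneSpectrum (𝓞 K) →₀ ℕ => g.prod fun v k => v.asIdeal ^ k) =
        fun g => g.prod (F u w s) := funext hfg
    rw [this]
    exact (summable_norm_prod_F hu1 hw1 hs).of_norm
  have hsupp' : Function.support f ⊆
      Set.range (fun g : HeightOneSpectrum (𝓞 K) →₀ ℕ => g.prod fun v k => v.asIdeal ^ k) := by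
    intro I hI
    by_contra hI'
    exact hI (hsupp I hI')
  have hftsum : ∑' I, f I = ∑' g : HeightOneSpectrum (𝓞 K) →₀ ℕ, g.prod (F u w s) := by
    rw [← hinj.tsum_eq hsupp']
    exact tsum_congr hfg
  -- regroup by the norm
  have h1 := hfsum.hasSum.tsum_fiberwise (Ideal.absNorm : Ideal (𝓞 K) → ℕ)
  rw [hftsum] at h1
  refine h1.congr_fun fun n => ?_
  have hset : ((Ideal.absNorm : Ideal (𝓞 K) → ℕ) ⁻¹' {n}) = ↑(idealsOfNorm K n) := by
    ext I; simp
  rw [tsum_congr_set_coe f hset, Finset.tsum_subtype' (idealsOfNorm K n) f, LSeries.term_def]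
  split_ifs with hn
  · subst hn
    have : idealsOfNorm K 0 = {⊥} := by
      ext I; simp [Ideal.absNorm_eq_zero_iff]
    rw [this, Finset.sum_singleton, hf]
    dsimp only
    rw [r_bot, zero_mul]
  · rw [coeff, Finset.sum_div, Finset.sum_congr rfl]
    intro I hI
    rw [mem_idealsOfNorm] at hI
    rw [hf]
    dsimp only
    rw [hI, Complex.cpow_neg, div_eq_mul_inv]

/-- `∑ a(n) n^{-s}` converges absolutely for `Re s > 1`. [folklore] -/
theorem LSeriesSummable_coeff {s : ℂ} (hs : 1 < s.re) : LSeriesSummable (coeff u w) s :=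
  (LSeriesHasSum_coeff hu1 hw1 hs).LSeriesSummable

/-- **The `L`-series identity**: for `Re s > 1`,
`L(a, s) = ζ_K(s) · ∏(1−u_vN v^{-s})⁻¹ · ∏(1−w_vN v^{-s})⁻¹ · ∏(1−u_vw_vN v^{-s})⁻¹`.
[cite: MontgomeryVaughan2007, §11.2 p. 285] -/
theorem LSeries_coeff_eq {s : ℂ} (hs : 1 < s.re) :
    LSeries (coeff u w) s =
      _root_.NumberField.dedekindZeta K s *
        (∏' v : HeightOneSpectrum (𝓞 K), (1 - u v * ((Ideal.absNorm v.asIdeal : ℕ) : ℂ) ^ (-s))⁻¹) *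
        (∏' v : HeightOneSpectrum (𝓞 K), (1 - w v * ((Ideal.absNorm v.asIdeal : ℕ) : ℂ) ^ (-s))⁻¹) *
        ∏' v : HeightOneSpectrum (𝓞 K), (1 - u v * w v * ((Ideal.absNorm v.asIdeal : ℕ) : ℂ) ^ (-s))⁻¹ := by
  rw [(LSeriesHasSum_coeff hu1 hw1 hs).LSeries_eq, tsum_prod_F_eq hu1 hw1 hs]

end LSeriesIdentity

/-! ### Packaged statements -/

/-- Values in `{−1, 0, 1}` have norm `≤ 1`. [folklore] -/
theorem norm_le_one_of_mem {z : ℂ} (hz : z = -1 ∨ z = 0 ∨ z = 1) : ‖z‖ ≤ 1 := by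
  rcases hz with rfl | rfl | rfl <;> simp

/-- **Non-negative coefficients of `ζ_K(s) L(s,u) L(s,w) L(s,uw)`** (Montgomery–Vaughan p. 285 over a number
field): for `u, w` with values in `{−1, 0, 1}` on the primes of `K` there is `a : ℕ → ℂ` with `a ≥ 0`,
`a(1) = 1`, `∑ a(n)n^{-s}` absolutely convergent for `Re s > 1` and equal there to
`ζ_K(s) ∏(1−u_vN v^{-s})⁻¹ ∏(1−w_vN v^{-s})⁻¹ ∏(1−u_vw_vN v^{-s})⁻¹` — namely `a = coeff u w`.
[cite: MontgomeryVaughan2007, §11.2 p. 285] -/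
theorem exists_nonneg_coeff (hu : ∀ v, u v = -1 ∨ u v = 0 ∨ u v = 1) (hw : ∀ v, w v = -1 ∨ w v = 0 ∨ w v = 1) :
    ∃ a : ℕ → ℂ, 0 ≤ a ∧ a 1 = 1 ∧ (∀ s : ℂ, 1 < s.re → LSeriesSummable a s) ∧
      ∀ s : ℂ, 1 < s.re → LSeries a s =
        _root_.NumberField.dedekindZeta K s *
          (∏' v : HeightOneSpectrum (𝓞 K), (1 - u v * ((Ideal.absNorm v.asIdeal : ℕ) : ℂ) ^ (-s))⁻¹) *
          (∏' v : HeightOneSpectrum (𝓞 K), (1 - w v * ((Ideal.absNorm v.asIdeal : ℕ) : ℂ) ^ (-s))⁻¹) *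
          ∏' v : HeightOneSpectrum (𝓞 K), (1 - u v * w v * ((Ideal.absNorm v.asIdeal : ℕ) : ℂ) ^ (-s))⁻¹ :=
  have hu1 : ∀ v, ‖u v‖ ≤ 1 := fun v => norm_le_one_of_mem (hu v)
  have hw1 : ∀ v, ‖w v‖ ≤ 1 := fun v => norm_le_one_of_mem (hw v)
  ⟨coeff u w, coeff_nonneg hu hw, coeff_one, fun _ hs => LSeriesSummable_coeff hu1 hw1 hs,
    fun _ hs => LSeries_coeff_eq hu1 hw1 hs⟩

/-- **The pair version: non-negative coefficients of `ζ_K(s) L(s, u)`** (`w = 0`; the coefficients are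
`a(n) = ∑_{N𝔞=n} ∑_{𝔡∣𝔞} u(𝔡)`). [cite: MontgomeryVaughan2007, §11.2 p. 285] -/
theorem exists_nonneg_coeff_pair (hu : ∀ v, u v = -1 ∨ u v = 0 ∨ u v = 1) :
    ∃ a : ℕ → ℂ, 0 ≤ a ∧ a 1 = 1 ∧ (∀ s : ℂ, 1 < s.re → LSeriesSummable a s) ∧
      ∀ s : ℂ, 1 < s.re → LSeries a s =
        _root_.NumberField.dedekindZeta K s *
          ∏' v : HeightOneSpectrum (𝓞 K), (1 - u v * ((Ideal.absNorm v.asIdeal : ℕ) : ℂ) ^ (-s))⁻¹ := by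
  obtain ⟨a, ha, ha1, hsum, hL⟩ := exists_nonneg_coeff (u := u) (w := fun _ => 0) hu (fun _ => Or.inr (Or.inl rfl))
  refine ⟨a, ha, ha1, hsum, fun s hs => ?_⟩
  rw [hL s hs]
  simp

/-! ### In the language of ray class characters -/

omit [NumberField K] in
/-- A ray class character is **real** if its values on the primes off `𝔪` are `±1`. [folklore] -/
theorem rayClassPrimeValue_mem_of_real {𝔪 : Ideal (𝓞 K)} {ψ : HeightOneSpectrum (𝓞 K) → ℂ}
    (hreal : ∀ v, ¬ 𝔪 ≤ v.asIdeal → ψ v = 1 ∨ ψ v = -1) (v : HeightOneSpectrum (𝓞 K)) :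
    rayClassPrimeValue 𝔪 ψ v = -1 ∨ rayClassPrimeValue 𝔪 ψ v = 0 ∨ rayClassPrimeValue 𝔪 ψ v = 1 := by
  classical
  unfold rayClassPrimeValue
  split_ifs with h
  · exact Or.inr (Or.inl rfl)
  · rcases hreal v h with h1 | h1
    · exact Or.inr (Or.inr h1)
    · exact Or.inl h1

omit [NumberField K] in
/-- `ψ'` of the product character `mod 𝔪₁𝔪₂` is the product of the `ψ'`'s (a prime contains `𝔪₁𝔪₂` iff it
contains `𝔪₁` or `𝔪₂`). [folklore] -/
theorem rayClassPrimeValue_mul (𝔪₁ 𝔪₂ : Ideal (𝓞 K)) (ψ₁ ψ₂ : HeightOneSpectrum (𝓞 K) → ℂ)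
    (v : HeightOneSpectrum (𝓞 K)) :
    rayClassPrimeValue (𝔪₁ * 𝔪₂) (fun v => ψ₁ v * ψ₂ v) v =
      rayClassPrimeValue 𝔪₁ ψ₁ v * rayClassPrimeValue 𝔪₂ ψ₂ v := by
  classical
  unfold rayClassPrimeValue
  have hiff : 𝔪₁ * 𝔪₂ ≤ v.asIdeal ↔ 𝔪₁ ≤ v.asIdeal ∨ 𝔪₂ ≤ v.asIdeal := Ideal.IsPrime.mul_le v.isPrime
  by_cases h1 : 𝔪₁ ≤ v.asIdeal
  · rw [if_pos (hiff.mpr (Or.inl h1)), if_pos h1, zero_mul]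
  · by_cases h2 : 𝔪₂ ≤ v.asIdeal
    · rw [if_pos (hiff.mpr (Or.inr h2)), if_pos h2, mul_zero]
    · rw [if_neg (fun h => (hiff.mp h).elim h1 h2), if_neg h1, if_neg h2]

/-- **Siegel's positivity input over a number field**: for real ray class characters `χ₁ mod 𝔪₁`,
`χ₂ mod 𝔪₂` (values `±1` on the primes off the moduli) there is `a ≥ 0` with `a(1) = 1`, absolutely
summable for `Re s > 1`, with
`∑ a(n) n^{-s} = ζ_K(s) L(χ₁, s) L(χ₂, s) L(χ₁χ₂, s)` there, `χ₁χ₂` taken `mod 𝔪₁𝔪₂`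
(`rayClassLSeries`). This is the field `coeff₃` of `SiegelFamilyData` (`SiegelTheoremAbstract.lean`) for the
family of real ray class characters. [cite: MontgomeryVaughan2007, §11.2 p. 285] -/
theorem exists_nonneg_coeff_rayClass {𝔪₁ 𝔪₂ : Ideal (𝓞 K)} (h𝔪₁ : 𝔪₁ ≠ ⊥) (h𝔪₂ : 𝔪₂ ≠ ⊥)
    {ψ₁ ψ₂ : HeightOneSpectrum (𝓞 K) → ℂ}
    (hreal₁ : ∀ v, ¬ 𝔪₁ ≤ v.asIdeal → ψ₁ v = 1 ∨ ψ₁ v = -1)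
    (hreal₂ : ∀ v, ¬ 𝔪₂ ≤ v.asIdeal → ψ₂ v = 1 ∨ ψ₂ v = -1) :
    ∃ a : ℕ → ℂ, 0 ≤ a ∧ a 1 = 1 ∧ (∀ s : ℂ, 1 < s.re → LSeriesSummable a s) ∧
      ∀ s : ℂ, 1 < s.re → LSeries a s =
        _root_.NumberField.dedekindZeta K s * rayClassLSeries 𝔪₁ ψ₁ s * rayClassLSeries 𝔪₂ ψ₂ s *
          rayClassLSeries (𝔪₁ * 𝔪₂) (fun v => ψ₁ v * ψ₂ v) s := by
  have hψ₁ : ∀ v, ¬ 𝔪₁ ≤ v.asIdeal → ‖ψ₁ v‖ ≤ 1 := fun v hv => by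
    rcases hreal₁ v hv with h | h <;> simp [h]
  have hψ₂ : ∀ v, ¬ 𝔪₂ ≤ v.asIdeal → ‖ψ₂ v‖ ≤ 1 := fun v hv => by
    rcases hreal₂ v hv with h | h <;> simp [h]
  have h𝔪 : 𝔪₁ * 𝔪₂ ≠ ⊥ := mul_ne_zero h𝔪₁ h𝔪₂
  have hψ : ∀ v, ¬ 𝔪₁ * 𝔪₂ ≤ v.asIdeal → ‖ψ₁ v * ψ₂ v‖ ≤ 1 := fun v hv => by
    have h1 : ¬ 𝔪₁ ≤ v.asIdeal := fun h => hv ((Ideal.IsPrime.mul_le v.isPrime).mpr (Or.inl h))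
    have h2 : ¬ 𝔪₂ ≤ v.asIdeal := fun h => hv ((Ideal.IsPrime.mul_le v.isPrime).mpr (Or.inr h))
    rw [norm_mul]; exact mul_le_one₀ (hψ₁ v h1) (norm_nonneg _) (hψ₂ v h2)
  obtain ⟨a, ha, ha1, hsum, hL⟩ := exists_nonneg_coeff (u := rayClassPrimeValue 𝔪₁ ψ₁)
    (w := rayClassPrimeValue 𝔪₂ ψ₂) (rayClassPrimeValue_mem_of_real hreal₁) (rayClassPrimeValue_mem_of_real hreal₂)
  refine ⟨a, ha, ha1, hsum, fun s hs => ?_⟩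
  rw [hL s hs, (hasProd_rayClassLSeries_rayClassPrimeValue h𝔪₁ hψ₁ hs).tprod_eq,
    (hasProd_rayClassLSeries_rayClassPrimeValue h𝔪₂ hψ₂ hs).tprod_eq]
  have heq : (fun v : HeightOneSpectrum (𝓞 K) =>
      (1 - rayClassPrimeValue 𝔪₁ ψ₁ v * rayClassPrimeValue 𝔪₂ ψ₂ v * ((Ideal.absNorm v.asIdeal : ℕ) : ℂ) ^ (-s))⁻¹) =
      fun v => (1 - rayClassPrimeValue (𝔪₁ * 𝔪₂) (fun v => ψ₁ v * ψ₂ v) v *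
        ((Ideal.absNorm v.asIdeal : ℕ) : ℂ) ^ (-s))⁻¹ := by
    funext v; rw [rayClassPrimeValue_mul]
  rw [heq, (hasProd_rayClassLSeries_rayClassPrimeValue h𝔪 hψ hs).tprod_eq]

/-- **The pair version for a real ray class character**: `∑ a(n) n^{-s} = ζ_K(s) L(χ, s)` with `a ≥ 0`,
`a(1) = 1` — the field `coeff₁` of `SiegelFamilyData`. [cite: MontgomeryVaughan2007, §11.2 p. 285] -/
theorem exists_nonneg_coeff_rayClass_pair {𝔪 : Ideal (𝓞 K)} (h𝔪 : 𝔪 ≠ ⊥)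
    {ψ : HeightOneSpectrum (𝓞 K) → ℂ} (hreal : ∀ v, ¬ 𝔪 ≤ v.asIdeal → ψ v = 1 ∨ ψ v = -1) :
    ∃ a : ℕ → ℂ, 0 ≤ a ∧ a 1 = 1 ∧ (∀ s : ℂ, 1 < s.re → LSeriesSummable a s) ∧
      ∀ s : ℂ, 1 < s.re → LSeries a s = _root_.NumberField.dedekindZeta K s * rayClassLSeries 𝔪 ψ s := by
  have hψ : ∀ v, ¬ 𝔪 ≤ v.asIdeal → ‖ψ v‖ ≤ 1 := fun v hv => by
    rcases hreal v hv with h | h <;> simp [h]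
  obtain ⟨a, ha, ha1, hsum, hL⟩ :=
    exists_nonneg_coeff_pair (u := rayClassPrimeValue 𝔪 ψ) (rayClassPrimeValue_mem_of_real hreal)
  refine ⟨a, ha, ha1, hsum, fun s hs => ?_⟩
  rw [hL s hs, (hasProd_rayClassLSeries_rayClassPrimeValue h𝔪 hψ hs).tprod_eq]

end SiegelIdealCoefficients

end Literature.NumberTheory.LFunctions

end
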